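import Literature.IUT.HodgeArakelov.ThetaEvaluationSettingAtModelTateInfty
import Literature.IUT.HodgeArakelov.EtaleThetaDataOfSettingProp24
import Literature.AnabelianGeometry.EtaleTheta.Discharge.Sec2Cor218iAtModelTateOddParity
import HarnessLib

/-!
# [IUTchII] Prop 2.2 (ii)′ AT THE [EtTh] MODEL OF RECORD `modelTate p = modelχq p 1 2` with the (H1) binder F-2633
# `PiYddCharacteristic C` SUPPLIED IN KERNEL from the extension property `hextΔ` ALONE — every prime `p`, no cyclotome,
# no `p mod 4` case (proof-only; L6 register row LF6-28 / F-0661; K-L6 «of-extends» re-keying of node IUTchII:Prop2.2(ii))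

S. Mochizuki, *Inter-universal Teichmüller theory II*, kurims manuscript (Dec. 2020) §2, Prop. 2.2 (ii) p. 66 l. 51–61
(«together with the condition of invariance with respect to `ι` [cf. [EtTh], Proposition 1.4, (ii); the proof of [EtTh],
Theorem 1.6, (iii)], determines a specific `μ_{2l}`- (respectively, `μ`-) orbit `θ^ι(Π_v) ⊆ θ(Π_v)` (respectively,
`∞θ^ι(Π_v) ⊆ ∞θ(Π_v))`»; claim key `Mochizuki2012`, DISPUTED, D-0012) [claim: Mochizuki2012, status: disputed]
(IUTchII §2 Prop 2.2 (ii), kurims p.66); §1 Prop. 1.4 p. 27 («`Π_Ÿ(Π) ⊆ Π` corresponding to `Ÿ`» — the (H1) clause typed as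
abc-iut-L6-t1's `EtaleThetaDataOfSetting.PiYddCharacteristic`, FACT-LIST F-2633) [claim: Mochizuki2012, status: disputed]
(IUTchII §1 Prop 1.4, kurims p.27); S. Mochizuki, *The étale theta function and its Frobenioid-theoretic manifestations*
[EtTh], Publ. RIMS **45** (2009) (refereed): Thm. 1.6 (i) PRIMS PDF p. 24 («`γ(Π^tp_{Ÿα}) = Π^tp_{Ÿβ}`»), Prop. 2.4 (i) p. 38
(every automorphism of `Π^tp_{X̲̲}` extends to `Π^tp_X`) [cite: MochizukiEtTh2009, Thm 1.6 (i) p.24].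

Cell `abc-iut`, seat abc-iut-w5-d169 (gen 10; holder-of-record lineage of the L6 consumer knits of node IUTchII:Prop2.2(ii),
p488875 / p489944), L6 register row **LF6-28** (plan/L6/LF-IUT.tsv v1, F-0661 `Prop22_ii'`, abc-iut-L6-lead L6 ROWS #3
2026-08-27T03:16:00Z). PROOF-ONLY companion: NO definition, NO instance, NO new named fact; every input consumed BY NAME and
nothing landed is edited or restated:
* abc-iut-w6-d051's FILE A `SettingModel.map_GtpYdd_eq_of_map_deltaTemp_eq` (p490639, row «THM16I-ODDPARITY-Γ@p≡3(4)»: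
  EVERY `Δ^tp_X`-stabilising topological automorphism of `Π^tp_X(modelχq p i 2)` maps `Π^tp_Ÿ` onto itself — every prime
  `p`, every `i`, over any automorphism of `G_{ℚ_p}`; chain p489409 abc-iut-w5-d089 → p489423 abc-iut-w4-d038 FILE B);
* abc-iut-L6-d6's `EtaleThetaDataOfSetting.piYddCharacteristic_of_prop24` (p419393: (H1) ⟸ the [EtTh] Prop. 2.4 (i)-shaped
  binder `hP24` «every topological automorphism of `Π^tp_{X̲̲}` extends to one of `Π^tp_X` stabilising `Π^tp_Ÿ`»);
* abc-iut-w5-d072's closers of record `SettingModel.prop22_ii'_modelTate` (p457878, the `μ_{2l}`-clause; every (R1) ι-datum /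
  class-level / §1 named-fact binder a theorem there), `SettingModel.prop22_ii'_modelTate_ofSection` (same file) and
  `SettingModel.exists_iotaInvariantTheta'_inftyClause_modelTate` (`ThetaEvaluationSettingAtModelTateInfty`, BOTH clauses).

STATE OF RECORD BEFORE THIS FILE (numbers, not adjectives). At the Tate datum of record (`D := modelTate p`, Galois factor
`inr`, class `η̈♯ = etaDdχq`, `X̲̲ := doubleUnderlineχqOfEtaRes`, any odd `l`) the three closers above display exactly ONE
anabelian Prop binder: (H1) `hchar : PiYddCharacteristic C` = F-2633 AT THE INSTANCE — whose `∀`-closure over all `X̲̲`-choices is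
REFUTED in the tree (abc-iut-L6-t19 `not_forall_piYddCharacteristic`) and whose value at the record `C` is SPLIT (abc-iut-w4-d044
2026-08-27T03:08:33Z: `Y`-level = a theorem; `Ÿ`-parity clause `L_Ÿ` = undecided, row «XPARITY-L3@modelTate»). ROUTE A of
record traded (H1) for F-0620 [EtTh] Cor. 2.18 (i) at `C.rigidData μ …` (`prop22_ii'_modelTate_of_cor218_i`, p458562).

WHAT THIS FILE PROVES.
§1 `SettingModel.piYddCharacteristic_modelχq_of_extends` — for EVERY étale-theta datum `E` over `modelχq p i 2` (every prime
   `p`, every `i`), EVERY `X̲̲`-choice `C : E.DoubleUnderline l`: (H1) `PiYddCharacteristic C` ⟸ `hextΔ` («every bi-continuous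
   automorphism of `Π^tp_{X̲̲}` extends to a `Δ^tp_X`-stabilising bi-continuous automorphism of `Π^tp_X`», the [EtTh] Prop. 2.4 (i)
   shape used by abc-iut-L6-d6 p477049 / abc-iut-L6-t2 p490266 / abc-iut-w6-d051 p490639) ALONE — NO cyclotome `μ`, NO `h15`,
   NO `hC`/`hS`, NO `p mod 4` side condition (one term: `piYddCharacteristic_of_prop24` ∘ FILE A). In particular, at the record
   `C`, abc-iut-w4-d044's parity clause `L_Ÿ` FOLLOWS from `hextΔ` (consistency datum for row «XPARITY-L3@modelTate»).
§2 `SettingModel.prop22_ii'_modelTate_ofSection_of_extends` / `SettingModel.prop22_ii'_modelTate_of_extends` — the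
   `μ_{2l}`-clause `Prop22_ii' Dec` of IUTchII:Prop2.2(ii)′ at the Tate instance (section datum of ANY continuous Galois section,
   resp. the datum of record) with (H1) SUPPLIED from `hextΔ`: displayed Prop binders = {`hextΔ`} (+ `hι` «`ι(Π^tp_{X̲̲}) = Π^tp_{X̲̲}`»
   in the section form; a theorem `map_Huuχq_inversionχq` at the record) + the [IUTchII]-side DATA `(S, eS, hl, T₀, Dec)`.
§3 `SettingModel.exists_iotaInvariantTheta'_inftyClause_modelTate_of_extends` — BOTH clauses
   `∃ Θ : IotaInvariantTheta' Dec, Θ.InftyClause` at the datum of record, displayed Prop binders = {`hextΔ`}, data = a cyclotome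
   tower `τ` (inhabited: abc-iut-L2-t8 `modelχq_nonempty_cyclotomeTower`) + the [IUTchII]-side data.
NET EFFECT for the K-L6 cell IUTchII:Prop2.2(ii) @ modelTate: residual-of-record {(H1) F-2633 at the instance} is RE-KEYED to
{`hextΔ`} — the displayed input moves UPSTREAM in print (Prop. 2.4 (i) is an input of the proofs of Thm. 1.6 / Cor. 2.18 (i))
exactly as abc-iut-L6-t2 did for Cor. 1.10 / 1.11 / 1.12 (p490266, `ThetaSettingCor112ModelTateOfExtends`). IS `hextΔ` ITSELF
DECIDED AT THE MODEL? NO tree theorem decides it (abc-iut-L6-t2's header, abc-iut-L6-d6's memo COR218I-AT-MODELTATE: no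
Nielsen-type theory of `Aut` of the open subgroup `Π^tp_{X̲̲}`); it is DISPLAYED, not endorsed — a re-keying, not a net discharge.

HONEST LABEL. `modelχq` / `modelTate` is a SEMI-SYNTHETIC model of the typed [EtTh] §1 interface (not the tempered `π₁` of a
curve, no theta FUNCTION): binder-discharge / joint-satisfiability evidence only. The [IUTchII] claim key `Mochizuki2012` is
DISPUTED (D-0012) and nothing of it is asserted; nothing of [EtTh] is asserted; no side is taken on [IUTchIII] Cor. 3.12; an
instance-form theorem at OUR model is not the print universal closure; typed ≠ proved; instantiated ≠ endorsed; nothing here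
bears on whether abc is proved or refuted. bears_on: LADDER-ABC:A2.L-K (K-L6 / LF6-28, IUTchII:Prop2.2(ii) instance form) →
LADDER-FRONTIER F-A2 (M·L6) → rung 0 `Summit.ABC`.
-/

noncomputable section

open Literature.AnabelianGeometry.EtaleTheta (ContH1 ThetaSetting)
open Literature.AnabelianGeometry.EtaleTheta
open _root_.Topology

namespace Literature.AnabelianGeometry.EtaleTheta.SettingModel

open Literature.IUT.HodgeArakelov Literature.IUT.HodgeArakelov.EtaleThetaDataOfSetting
open Literature.AnabelianGeometry.SemiGraphs

variable (p : ℕ) [Fact p.Prime]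

/-! ## §1. (H1) `PiYddCharacteristic` over the stage-2 Tate model FROM `hextΔ` ALONE — every `p`, every `i`, every `C` -/

/-- **(H1) F-2633 `PiYddCharacteristic C` at `modelχq p i 2` FROM THE EXTENSION PROPERTY ALONE**: for every étale-theta datum
`E` over the stage-2 Tate model (every prime `p`, every `i`) and every `X̲̲`-choice `C`, if every bi-continuous automorphism of
`Π^tp_{X̲̲}` extends to a `Δ^tp_X`-stabilising bi-continuous automorphism of `Π^tp_X` (`hextΔ`, the [EtTh] Prop. 2.4 (i) shape),
then every bi-continuous automorphism of `Π^tp_{X̲̲}` stabilises `Π^tp_{Ÿ̲̲} = Π^tp_Ÿ ∩ Π^tp_{X̲̲}` — abc-iut-L6-d6's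
`piYddCharacteristic_of_prop24` with its `Π^tp_Ÿ`-stabilisation clause SUPPLIED by abc-iut-w6-d051's FILE A
`map_GtpYdd_eq_of_map_deltaTemp_eq` (every `Δ^tp_X`-stabilising `Γ` maps `Π^tp_Ÿ` onto itself, unconditionally in `p`).
No cyclotome, no [EtTh] Prop. 1.5 (iii), no `p mod 4` side condition. CONDITIONAL-AT-MODEL on `hextΔ` only.
[claim: Mochizuki2012, status: disputed] (IUTchII §1 Prop 1.4, kurims p.27) -/
theorem piYddCharacteristic_modelχq_of_extends (i : ℤ) {E : (ThetaSetting.modelχq p i 2 even_two).EtaleThetaData}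
    {l : ℕ} (C : E.DoubleUnderline l)
    (hext : ∀ γ : ↥C.Huu ≃ₜ* ↥C.Huu, ∃ Γ : PiTpχq p i 2 ≃ₜ* PiTpχq p i 2,
      (∀ h : C.Huu, Γ (h : PiTpχq p i 2) = ((γ h : C.Huu) : PiTpχq p i 2)) ∧
        (curveχq p i 2).DeltaTemp.map Γ.toMulEquiv.toMonoidHom = (curveχq p i 2).DeltaTemp) :
    PiYddCharacteristic C := by
  refine piYddCharacteristic_of_prop24 C fun γ => ?_
  obtain ⟨Γ, hΓ, hΔ⟩ := hext γ
  exact ⟨Γ, hΓ, map_GtpYdd_eq_of_map_deltaTemp_eq p i Γ hΔ⟩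

/-! ## §2. The `μ_{2l}`-clause of IUTchII:Prop2.2(ii)′ at the Tate instance with (H1) supplied from `hextΔ` -/

section TateSection

variable (s : GQp p →* (ThetaSetting.modelTate p).PiTemp) (hs : Continuous s)
  (hsec : ∀ σ : GQp p, (ThetaSetting.modelTate p).aug (s σ) = σ)
  (hsY : (ThetaSetting.modelTate p).GK.map s ≤ (ThetaSetting.modelTate p).GtpY)
  (hsYdd : (ThetaSetting.modelTate p).GKdd.map s ≤ (ThetaSetting.modelTate p).GtpYdd)

/-- **IUTchII:Prop2.2(ii)′ — the `μ_{2l}`-clause AT THE TATE INSTANCE, section datum `E_s` of ANY continuous Galois section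
`s`, for EVERY `ι`-stable `X̲̲`-choice `C`, with (H1) SUPPLIED from `hextΔ`**: abc-iut-w5-d072's `prop22_ii'_modelTate_ofSection`
with `hchar := piYddCharacteristic_modelχq_of_extends …`. Displayed Prop binders: `hι` («`ι(Π^tp_{X̲̲}) = Π^tp_{X̲̲}`») and
`hextΔ`; the rest is the [IUTchII]-side DATA `(S, eS, hl, T₀, Dec)`. CONDITIONAL-AT-MODEL on `hextΔ`.
[claim: Mochizuki2012, status: disputed] (IUTchII §2 Prop 2.2 (ii), kurims p.66) -/
theorem prop22_ii'_modelTate_ofSection_of_extends {l : ℕ}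
    (C : (((kummerCoreχq p 1 2 even_two).toKummerDataOfSection s hs hsec hsY hsYdd).etaleThetaDataOfClass
      (etaDdχq p 1 2 even_two)).DoubleUnderline l)
    (hι : C.Huu.map (inversionχq p 1 2).toMulEquiv.toMonoidHom = C.Huu)
    (hext : ∀ γ : ↥C.Huu ≃ₜ* ↥C.Huu, ∃ Γ : PiTpχq p 1 2 ≃ₜ* PiTpχq p 1 2,
      (∀ h : C.Huu, Γ (h : PiTpχq p 1 2) = ((γ h : C.Huu) : PiTpχq p 1 2)) ∧
        (curveχq p 1 2).DeltaTemp.map Γ.toMulEquiv.toMonoidHom = (curveχq p 1 2).DeltaTemp)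
    (S : BadPlaceSetting.{0}) (eS : (Pi C) ≃ₜ* S.PiX) (hl : S.l = l) {T₀ : TemperedCoverings S (Pi C)}
    (Dec : SubgraphDecomposition S T₀ (etaleThetaDataOfSetting' C (compat_modelχq p 1 2 even_two)
      (ThetaSetting.modelχq_sec2Hyps p 1 2 even_two) (piYddCharacteristic_modelχq_of_extends p 1 C hext)
      S.toThetaSetting eS hl)) :
    Prop22_ii' Dec :=
  prop22_ii'_modelTate_ofSection p s hs hsec hsY hsYdd C hι (piYddCharacteristic_modelχq_of_extends p 1 C hext) S eS hl Dec

end TateSection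

/-- **IUTchII:Prop2.2(ii)′ — the `μ_{2l}`-clause AT THE [EtTh] MODEL OF RECORD** (`modelTate p`, Galois factor `inr`, class
`η̈♯ = etaDdχq`, `X̲̲ := doubleUnderlineχqOfEtaRes`), for every odd `l`, **with (H1) SUPPLIED from `hextΔ`**: abc-iut-w5-d072's
closer of record `prop22_ii'_modelTate` (p457878) with `hchar := piYddCharacteristic_modelχq_of_extends …`. Displayed Prop
binders: `hextΔ` ONLY (was: (H1) F-2633 at the instance); the rest is the [IUTchII]-side DATA `(S, eS, hl, T₀, Dec)`.
CONDITIONAL-AT-MODEL on `hextΔ`; SEMI-SYNTHETIC MODEL, binder-discharge evidence only; no side taken on [IUTchIII] Cor. 3.12.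
[claim: Mochizuki2012, status: disputed] (IUTchII §2 Prop 2.2 (ii), kurims p.66) -/
theorem prop22_ii'_modelTate_of_extends (l : ℕ+) (hlo : Odd (l : ℕ))
    (hext : ∀ γ : ↥((((kummerCoreχq p 1 2 even_two).toKummerDataOfSection SemidirectProduct.inr (continuous_inrχq p 1 2)
        (fun _ => rfl) (map_inr_GK_le_GtpY_modelχq' p 1 2 even_two)
        (map_inr_GKdd_le_GtpYdd_modelχq' p 1 2 even_two)).etaleThetaDataOfClass
        (etaDdχq p 1 2 even_two)).doubleUnderlineχqOfEtaRes p 1 2 l hlo (eta_res_etaDdχq p 1 2 even_two l hlo)).Huu ≃ₜ*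
        ↥((((kummerCoreχq p 1 2 even_two).toKummerDataOfSection SemidirectProduct.inr (continuous_inrχq p 1 2)
        (fun _ => rfl) (map_inr_GK_le_GtpY_modelχq' p 1 2 even_two)
        (map_inr_GKdd_le_GtpYdd_modelχq' p 1 2 even_two)).etaleThetaDataOfClass
        (etaDdχq p 1 2 even_two)).doubleUnderlineχqOfEtaRes p 1 2 l hlo (eta_res_etaDdχq p 1 2 even_two l hlo)).Huu,
      ∃ Γ : PiTpχq p 1 2 ≃ₜ* PiTpχq p 1 2,
        (∀ h : ((((kummerCoreχq p 1 2 even_two).toKummerDataOfSection SemidirectProduct.inr (continuous_inrχq p 1 2)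
          (fun _ => rfl) (map_inr_GK_le_GtpY_modelχq' p 1 2 even_two)
          (map_inr_GKdd_le_GtpYdd_modelχq' p 1 2 even_two)).etaleThetaDataOfClass
          (etaDdχq p 1 2 even_two)).doubleUnderlineχqOfEtaRes p 1 2 l hlo (eta_res_etaDdχq p 1 2 even_two l hlo)).Huu,
          Γ (h : PiTpχq p 1 2) = ((γ h : ((((kummerCoreχq p 1 2 even_two).toKummerDataOfSection SemidirectProduct.inr
            (continuous_inrχq p 1 2) (fun _ => rfl) (map_inr_GK_le_GtpY_modelχq' p 1 2 even_two)
            (map_inr_GKdd_le_GtpYdd_modelχq' p 1 2 even_two)).etaleThetaDataOfClass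
            (etaDdχq p 1 2 even_two)).doubleUnderlineχqOfEtaRes p 1 2 l hlo (eta_res_etaDdχq p 1 2 even_two l hlo)).Huu) :
            PiTpχq p 1 2)) ∧
        (curveχq p 1 2).DeltaTemp.map Γ.toMulEquiv.toMonoidHom = (curveχq p 1 2).DeltaTemp)
    (S : BadPlaceSetting.{0})
    (eS : (Pi ((((kummerCoreχq p 1 2 even_two).toKummerDataOfSection SemidirectProduct.inr (continuous_inrχq p 1 2)
        (fun _ => rfl) (map_inr_GK_le_GtpY_modelχq' p 1 2 even_two)
        (map_inr_GKdd_le_GtpYdd_modelχq' p 1 2 even_two)).etaleThetaDataOfClass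
        (etaDdχq p 1 2 even_two)).doubleUnderlineχqOfEtaRes p 1 2 l hlo (eta_res_etaDdχq p 1 2 even_two l hlo))) ≃ₜ*
      S.PiX)
    (hl : S.l = l)
    {T₀ : TemperedCoverings S (Pi ((((kummerCoreχq p 1 2 even_two).toKummerDataOfSection SemidirectProduct.inr
        (continuous_inrχq p 1 2) (fun _ => rfl) (map_inr_GK_le_GtpY_modelχq' p 1 2 even_two)
        (map_inr_GKdd_le_GtpYdd_modelχq' p 1 2 even_two)).etaleThetaDataOfClass
        (etaDdχq p 1 2 even_two)).doubleUnderlineχqOfEtaRes p 1 2 l hlo (eta_res_etaDdχq p 1 2 even_two l hlo)))}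
    (Dec : SubgraphDecomposition S T₀ (etaleThetaDataOfSetting'
      ((((kummerCoreχq p 1 2 even_two).toKummerDataOfSection SemidirectProduct.inr (continuous_inrχq p 1 2)
        (fun _ => rfl) (map_inr_GK_le_GtpY_modelχq' p 1 2 even_two)
        (map_inr_GKdd_le_GtpYdd_modelχq' p 1 2 even_two)).etaleThetaDataOfClass
        (etaDdχq p 1 2 even_two)).doubleUnderlineχqOfEtaRes p 1 2 l hlo (eta_res_etaDdχq p 1 2 even_two l hlo))
      (compat_modelχq p 1 2 even_two) (ThetaSetting.modelχq_sec2Hyps p 1 2 even_two)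
      (piYddCharacteristic_modelχq_of_extends p 1 _ hext) S.toThetaSetting eS hl)) :
    Prop22_ii' Dec :=
  prop22_ii'_modelTate p l hlo (piYddCharacteristic_modelχq_of_extends p 1 _ hext) S eS hl Dec

/-! ## §3. BOTH clauses of IUTchII:Prop2.2(ii)′ at the datum of record with (H1) supplied from `hextΔ` -/

/-- **BOTH clauses of IUTchII:Prop2.2(ii)′ AT THE [EtTh] MODEL OF RECORD with (H1) SUPPLIED from `hextΔ`**: for every odd `l`,
every cyclotome tower `τ` (DATA; inhabited by abc-iut-L2-t8's `modelχq_nonempty_cyclotomeTower`) and EVERY [IUTchII]-side datum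
`(S, eS, hl, T₀, Dec)`: `∃ Θ : IotaInvariantTheta' Dec, Θ.InftyClause` — abc-iut-w5-d072's
`exists_iotaInvariantTheta'_inftyClause_modelTate` with `hchar := piYddCharacteristic_modelχq_of_extends …`. Displayed Prop
binders: `hextΔ` ONLY. CONDITIONAL-AT-MODEL on `hextΔ`; SEMI-SYNTHETIC MODEL; no side taken on [IUTchIII] Cor. 3.12.
[claim: Mochizuki2012, status: disputed] (IUTchII §2 Prop 2.2 (ii), kurims p.66) -/
theorem exists_iotaInvariantTheta'_inftyClause_modelTate_of_extends (l : ℕ+) (hlo : Odd (l : ℕ)) {Es : Set ℕ+}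
    (τ : (ThetaSetting.modelTate p).CyclotomeTower l Es)
    (hext : ∀ γ : ↥((((kummerCoreχq p 1 2 even_two).toKummerDataOfSection SemidirectProduct.inr (continuous_inrχq p 1 2)
        (fun _ => rfl) (map_inr_GK_le_GtpY_modelχq' p 1 2 even_two)
        (map_inr_GKdd_le_GtpYdd_modelχq' p 1 2 even_two)).etaleThetaDataOfClass
        (etaDdχq p 1 2 even_two)).doubleUnderlineχqOfEtaRes p 1 2 l hlo (eta_res_etaDdχq p 1 2 even_two l hlo)).Huu ≃ₜ*
        ↥((((kummerCoreχq p 1 2 even_two).toKummerDataOfSection SemidirectProduct.inr (continuous_inrχq p 1 2)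
        (fun _ => rfl) (map_inr_GK_le_GtpY_modelχq' p 1 2 even_two)
        (map_inr_GKdd_le_GtpYdd_modelχq' p 1 2 even_two)).etaleThetaDataOfClass
        (etaDdχq p 1 2 even_two)).doubleUnderlineχqOfEtaRes p 1 2 l hlo (eta_res_etaDdχq p 1 2 even_two l hlo)).Huu,
      ∃ Γ : PiTpχq p 1 2 ≃ₜ* PiTpχq p 1 2,
        (∀ h : ((((kummerCoreχq p 1 2 even_two).toKummerDataOfSection SemidirectProduct.inr (continuous_inrχq p 1 2)
          (fun _ => rfl) (map_inr_GK_le_GtpY_modelχq' p 1 2 even_two)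
          (map_inr_GKdd_le_GtpYdd_modelχq' p 1 2 even_two)).etaleThetaDataOfClass
          (etaDdχq p 1 2 even_two)).doubleUnderlineχqOfEtaRes p 1 2 l hlo (eta_res_etaDdχq p 1 2 even_two l hlo)).Huu,
          Γ (h : PiTpχq p 1 2) = ((γ h : ((((kummerCoreχq p 1 2 even_two).toKummerDataOfSection SemidirectProduct.inr
            (continuous_inrχq p 1 2) (fun _ => rfl) (map_inr_GK_le_GtpY_modelχq' p 1 2 even_two)
            (map_inr_GKdd_le_GtpYdd_modelχq' p 1 2 even_two)).etaleThetaDataOfClass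
            (etaDdχq p 1 2 even_two)).doubleUnderlineχqOfEtaRes p 1 2 l hlo (eta_res_etaDdχq p 1 2 even_two l hlo)).Huu) :
            PiTpχq p 1 2)) ∧
        (curveχq p 1 2).DeltaTemp.map Γ.toMulEquiv.toMonoidHom = (curveχq p 1 2).DeltaTemp)
    (S : BadPlaceSetting.{0})
    (eS : (Pi ((((kummerCoreχq p 1 2 even_two).toKummerDataOfSection SemidirectProduct.inr (continuous_inrχq p 1 2)
        (fun _ => rfl) (map_inr_GK_le_GtpY_modelχq' p 1 2 even_two)
        (map_inr_GKdd_le_GtpYdd_modelχq' p 1 2 even_two)).etaleThetaDataOfClass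
        (etaDdχq p 1 2 even_two)).doubleUnderlineχqOfEtaRes p 1 2 l hlo (eta_res_etaDdχq p 1 2 even_two l hlo))) ≃ₜ*
      S.PiX)
    (hl : S.l = l)
    {T₀ : TemperedCoverings S (Pi ((((kummerCoreχq p 1 2 even_two).toKummerDataOfSection SemidirectProduct.inr
        (continuous_inrχq p 1 2) (fun _ => rfl) (map_inr_GK_le_GtpY_modelχq' p 1 2 even_two)
        (map_inr_GKdd_le_GtpYdd_modelχq' p 1 2 even_two)).etaleThetaDataOfClass
        (etaDdχq p 1 2 even_two)).doubleUnderlineχqOfEtaRes p 1 2 l hlo (eta_res_etaDdχq p 1 2 even_two l hlo)))}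
    (Dec : SubgraphDecomposition S T₀ (etaleThetaDataOfSetting'
      ((((kummerCoreχq p 1 2 even_two).toKummerDataOfSection SemidirectProduct.inr (continuous_inrχq p 1 2)
        (fun _ => rfl) (map_inr_GK_le_GtpY_modelχq' p 1 2 even_two)
        (map_inr_GKdd_le_GtpYdd_modelχq' p 1 2 even_two)).etaleThetaDataOfClass
        (etaDdχq p 1 2 even_two)).doubleUnderlineχqOfEtaRes p 1 2 l hlo (eta_res_etaDdχq p 1 2 even_two l hlo))
      (compat_modelχq p 1 2 even_two) (ThetaSetting.modelχq_sec2Hyps p 1 2 even_two)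
      (piYddCharacteristic_modelχq_of_extends p 1 _ hext) S.toThetaSetting eS hl)) :
    ∃ Θ : IotaInvariantTheta' Dec, Θ.InftyClause :=
  exists_iotaInvariantTheta'_inftyClause_modelTate p l hlo τ (piYddCharacteristic_modelχq_of_extends p 1 _ hext) S eS hl Dec

end Literature.AnabelianGeometry.EtaleTheta.SettingModel

end
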